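import Literature.Analysis.FluidPDE.PassiveVectorTensorModalAdjointCoeff
import Literature.Analysis.FunctionSpaces.TorusTrigPolyDerivBounds
import HarnessLib

/-!
# The MODAL ADJOINT FIELD of the constant-tensor passive-vector operator: a classical, divergence-free,
# time-Lipschitz space-smooth solution of the backward adjoint problem `∂_τ φ + 𝓛_𝔸^* φ = ∇q`

Analysis/FluidPDE support file (definitions + proved lemmas; no named facts), continuation of
`PassiveVectorTensorModalAdjointCoeff` (the coefficient curve `c(τ) = exp((τ − t) L_k) z`, `c′ = L_k c`,
transversality, backward energy decay).  Here the SPACE–TIME FIELD `φ τ = Re(e_k • c(τ))`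
(`realTrigPoly {k}`) is shown to have exactly the regularity that the weak formulations with
time-Lipschitz tests consume (`Torus.IsLipschitzSpaceTimeTest`-type clauses of
`PassiveVectorTensorDistorted` / `…DistortedDuality` §2): smooth slices, ALL iterated space derivatives
jointly continuous in `(τ, y)`, Lipschitz in `τ` on `[0,T]` uniformly in `y`, an everywhere time derivative
`φ′ τ = Re(e_k • L_k c(τ))`, divergence-free slices (`k ≠ 0`, `k · z = 0`), the terminal value
`φ t = Re(e_k • z)`, sup bounds — and the pointwise ADJOINT IDENTITY
`φ′ τ y + 𝓛_𝔸^*(φ τ) y = ∇(q τ) y` with the explicit single-mode pressure `q τ = Re(e_k · g(τ)/(2πi))`,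
`g(τ) = −4π² (k · T_𝔸(k) c(τ))/|k|²` (`viscAdj_realTrigPoly_singleton`: plane waves go to plane waves under
`𝓛_𝔸^*`; the pressure removes the longitudinal part).  This is the one-mode classical solution of the adjoint
parabolic problem of transposition/duality arguments (Lions–Magenes, Ch. 3 §4.3), with Temam's Fourier
characterisation of solenoidal fields (Ch. III §1.1) and Frisch's plane-wave symbol of the eddy-viscosity
tensor (9.57).

Consumer: cell `ad-ideate`, K1L_D `stmt-AnomalousDissipation-27980`, S23‴ sub-stub W3 re-typed W3a/W3c (tenure
D25-3): the admissible tests of the distorted class are `(∇X) • φ` with `φ` this field; the flat side pairs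
explicitly.  NOT a statement about the crux or about anomalous dissipation.

## Mathlib / tree search
Tree: `realTrigPoly` API (`isSmooth_realTrigPoly`, `iterPartialDeriv_realTrigPoly`, `realTrigPoly_singleton_apply`,
`norm_realTrigPoly_singleton_le`, `isDivFree_realTrigPoly`, `realTrigPoly_add/sub/congr`), `viscAdj_realTrigPoly_singleton`,
`partialDeriv_re_trigPoly`, `isSmooth_re_trigPoly`, `gradient_eq_sum_partialDeriv`; Mathlib
`Convex.norm_image_sub_le_of_norm_deriv_le`, `IsCompact.exists_bound_of_continuousOn`,
`ContinuousLinearMap.hasFDerivAt.comp_hasDerivAt`.  No classical modal adjoint field existed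
(`rg "modalAdj" Literature`: only the companion file).

## References
* J.-L. Lions, E. Magenes, *Non-Homogeneous Boundary Value Problems* I (Springer 1972), Ch. 3 §4.3. [`LionsMagenes1972`]
* R. Temam, *Navier–Stokes Equations* (AMS Chelsea 1984/2001), Ch. III §1.1. [`Temam1984`]
* U. Frisch, *Turbulence* (CUP 1995), §9.6.3 eq. (9.57) p. 233. [`Frisch1995Turbulence`]
-/

noncomputable section

open MeasureTheory Set Filter Complex
open scoped InnerProductSpace ComplexConjugate NNReal

namespace Literature.Analysis.FluidPDE

namespace Torus

variable {d : Type*} [Fintype d] [DecidableEq d]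

/-! ## §3 The modal adjoint FIELD `φ(τ) = Re(e_k • c(τ))` and its test-class properties -/

section Field

open FunctionSpaces FunctionSpaces.Torus UnitAddTorus

/-- **The modal adjoint field** with terminal value `Re(e_k • z)` at time `t`: `φ τ = Re(e_k • c(τ))`,
`c(τ) = exp((τ − t) L_k) z`. [cite: LionsMagenes1972, Ch. 3 §4.3] -/
def modalAdjField (𝔸 : Visc4 d) (k : d → ℤ) (t : ℝ) (z : EuclideanSpace ℂ d) :
    ℝ → UnitAddTorus d → EuclideanSpace ℝ d :=
  fun τ => realTrigPoly {k} (fun _ => modalAdjCoeff 𝔸 k t z τ)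

/-- **Its time derivative** `φ′ τ = Re(e_k • L_k c(τ))`. [cite: LionsMagenes1972, Ch. 3 §4.3] -/
def modalAdjFieldDeriv (𝔸 : Visc4 d) (k : d → ℤ) (t : ℝ) (z : EuclideanSpace ℂ d) :
    ℝ → UnitAddTorus d → EuclideanSpace ℝ d :=
  fun τ => realTrigPoly {k} (fun _ => modalAdjGen 𝔸 k (modalAdjCoeff 𝔸 k t z τ))

/-- The GRADIENT COEFFICIENT of the modal pressure: `g(τ) = −4π² (k · T_𝔸(k) c(τ)) / |k|²`
(so that `L_k c − 4π² T_𝔸(k) c = g • k`). [cite: LionsMagenes1972, Ch. 3 §4.3] -/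
def modalAdjGradCoeff (𝔸 : Visc4 d) (k : d → ℤ) (t : ℝ) (z : EuclideanSpace ℂ d) (τ : ℝ) : ℂ :=
  -((4 * Real.pi ^ 2 : ℝ) : ℂ) * ((freqNormSq k : ℂ)⁻¹ * kdot k (symbT 𝔸 k (modalAdjCoeff 𝔸 k t z τ)))

/-- **The modal pressure** `q τ y = Re(e_k(y) · g(τ)/(2πi))`, whose gradient is `Re(e_k • g(τ) k)`. [cite: LionsMagenes1972, Ch. 3 §4.3] -/
def modalAdjPressure (𝔸 : Visc4 d) (k : d → ℤ) (t : ℝ) (z : EuclideanSpace ℂ d) : ℝ → UnitAddTorus d → ℝ :=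
  fun τ y => (trigPoly {k} (fun _ => (2 * Real.pi * Complex.I)⁻¹ * modalAdjGradCoeff 𝔸 k t z τ) y).re

omit [DecidableEq d] in
/-- Unfolding the field at a point: `φ τ y = Re(e_k(y) • c τ)`. [cite: LionsMagenes1972, Ch. 3 §4.3] -/
theorem modalAdjField_apply (𝔸 : Visc4 d) (k : d → ℤ) (t : ℝ) (z : EuclideanSpace ℂ d) (τ : ℝ) (y : UnitAddTorus d) :
    modalAdjField 𝔸 k t z τ y = EuclideanSpace.realPart (mFourier k y • modalAdjCoeff 𝔸 k t z τ) := by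
  rw [modalAdjField, realTrigPoly_singleton_apply]

omit [DecidableEq d] in
/-- Terminal slice: `φ t = Re(e_k • z)`. [cite: LionsMagenes1972, Ch. 3 §4.3] -/
theorem modalAdjField_self (𝔸 : Visc4 d) (k : d → ℤ) (t : ℝ) (z : EuclideanSpace ℂ d) :
    modalAdjField 𝔸 k t z t = realTrigPoly {k} (fun _ => z) := by
  simp only [modalAdjField, modalAdjCoeff_self]

omit [DecidableEq d] in
/-- Every slice is smooth. [cite: LionsMagenes1972, Ch. 3 §4.3] -/
theorem isSmooth_modalAdjField (𝔸 : Visc4 d) (k : d → ℤ) (t : ℝ) (z : EuclideanSpace ℂ d) (τ : ℝ) :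
    IsSmooth (modalAdjField 𝔸 k t z τ) :=
  isSmooth_realTrigPoly _ _

/-- Iterated space derivatives of the slices: `∂^l φ τ = Re(e_k • (derivMultiplier l k • c τ))`. [cite: LionsMagenes1972, Ch. 3 §4.3] -/
theorem iterPartialDeriv_modalAdjField (𝔸 : Visc4 d) (k : d → ℤ) (t : ℝ) (z : EuclideanSpace ℂ d) (l : List d) (τ : ℝ) :
    iterPartialDeriv l (modalAdjField 𝔸 k t z τ) =
      realTrigPoly {k} (fun k' => derivMultiplier l k' • modalAdjCoeff 𝔸 k t z τ) := by
  rw [modalAdjField, iterPartialDeriv_realTrigPoly]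

/-- **Joint continuity of all iterated space derivatives** in `(τ, y)` (the `IsLipschitzSpaceTimeTest`
regularity clause). [cite: LionsMagenes1972, Ch. 3 §4.3] -/
theorem continuous_uncurry_iterPartialDeriv_modalAdjField (𝔸 : Visc4 d) (k : d → ℤ) (t : ℝ) (z : EuclideanSpace ℂ d)
    (l : List d) :
    Continuous (Function.uncurry fun τ y => iterPartialDeriv l (modalAdjField 𝔸 k t z τ) y) := by
  have e : (Function.uncurry fun τ y => iterPartialDeriv l (modalAdjField 𝔸 k t z τ) y) =
      fun p : ℝ × UnitAddTorus d => EuclideanSpace.realPart (mFourier k p.2 • (derivMultiplier l k • modalAdjCoeff 𝔸 k t z p.1)) := by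
    funext p
    rw [Function.uncurry_apply_pair, iterPartialDeriv_modalAdjField, realTrigPoly_singleton_apply]
  rw [e]
  refine (EuclideanSpace.realPart (ι := d)).continuous.comp ?_
  exact ((mFourier k).continuous.comp continuous_snd).smul
    (((continuous_modalAdjCoeff 𝔸 k t z).comp continuous_fst).const_smul (derivMultiplier l k))

omit [DecidableEq d] in
/-- Joint continuity of the field itself. [cite: LionsMagenes1972, Ch. 3 §4.3] -/
theorem continuous_uncurry_modalAdjField (𝔸 : Visc4 d) (k : d → ℤ) (t : ℝ) (z : EuclideanSpace ℂ d) :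
    Continuous (Function.uncurry (modalAdjField 𝔸 k t z)) := by
  have e : Function.uncurry (modalAdjField 𝔸 k t z) =
      fun p : ℝ × UnitAddTorus d => EuclideanSpace.realPart (mFourier k p.2 • modalAdjCoeff 𝔸 k t z p.1) := by
    funext p
    rw [Function.uncurry_apply_pair, modalAdjField_apply]
  rw [e]
  exact (EuclideanSpace.realPart (ι := d)).continuous.comp
    (((mFourier k).continuous.comp continuous_snd).smul ((continuous_modalAdjCoeff 𝔸 k t z).comp continuous_fst))

omit [DecidableEq d] in
/-- The slices as the image of the coefficient under a fixed real-linear map: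
`φ s y = Φ_y (c s)`, `Φ_y w = Re(e_k(y) • w)`. [cite: LionsMagenes1972, Ch. 3 §4.3] -/
theorem modalAdjField_eq_clm_apply (𝔸 : Visc4 d) (k : d → ℤ) (t : ℝ) (z : EuclideanSpace ℂ d) (y : UnitAddTorus d) (s : ℝ) :
    modalAdjField 𝔸 k t z s y =
      ((EuclideanSpace.realPart (ι := d)).comp
        (((mFourier k y) • ContinuousLinearMap.id ℂ (EuclideanSpace ℂ d)).restrictScalars ℝ)) (modalAdjCoeff 𝔸 k t z s) := by
  rw [modalAdjField_apply]
  rfl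

omit [DecidableEq d] in
/-- **Time derivative of the field at every point**: `HasDerivAt (φ · y) (φ′ τ y) τ`. [cite: LionsMagenes1972, Ch. 3 §4.3] -/
theorem hasDerivAt_modalAdjField (𝔸 : Visc4 d) (k : d → ℤ) (t : ℝ) (z : EuclideanSpace ℂ d) (τ : ℝ) (y : UnitAddTorus d) :
    HasDerivAt (fun s => modalAdjField 𝔸 k t z s y) (modalAdjFieldDeriv 𝔸 k t z τ y) τ := by
  have h := ((EuclideanSpace.realPart (ι := d)).comp
    (((mFourier k y) • ContinuousLinearMap.id ℂ (EuclideanSpace ℂ d)).restrictScalars ℝ)).hasFDerivAt.comp_hasDerivAt τ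
    (hasDerivAt_modalAdjCoeff 𝔸 k t z τ)
  have e1 : (⇑((EuclideanSpace.realPart (ι := d)).comp
      (((mFourier k y) • ContinuousLinearMap.id ℂ (EuclideanSpace ℂ d)).restrictScalars ℝ)) ∘ modalAdjCoeff 𝔸 k t z) =
      fun s => modalAdjField 𝔸 k t z s y := by
    funext s; rw [Function.comp_apply, modalAdjField_eq_clm_apply]
  have e2 : ((EuclideanSpace.realPart (ι := d)).comp
      (((mFourier k y) • ContinuousLinearMap.id ℂ (EuclideanSpace ℂ d)).restrictScalars ℝ))
      (modalAdjGen 𝔸 k (modalAdjCoeff 𝔸 k t z τ)) = modalAdjFieldDeriv 𝔸 k t z τ y := by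
    rw [modalAdjFieldDeriv, realTrigPoly_singleton_apply]; rfl
  rw [e1, e2] at h
  exact h

omit [DecidableEq d] in
/-- **Lipschitz in time, uniformly in space**, on every interval `[0,T]` (the coefficient curve is `C¹`,
`‖Re(e_k • w)‖ ≤ ‖w‖`). [cite: LionsMagenes1972, Ch. 3 §4.3] -/
theorem exists_lipschitz_modalAdjField (𝔸 : Visc4 d) (k : d → ℤ) (t : ℝ) (z : EuclideanSpace ℂ d) (T : ℝ) :
    ∃ L : ℝ, 0 ≤ L ∧ ∀ τ ∈ Icc (0:ℝ) T, ∀ s ∈ Icc (0:ℝ) T, ∀ y,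
      ‖modalAdjField 𝔸 k t z τ y - modalAdjField 𝔸 k t z s y‖ ≤ L * |τ - s| := by
  -- a bound for `‖L_k (c σ)‖` on the compact interval
  obtain ⟨C, hC⟩ := (isCompact_Icc (a := (0:ℝ)) (b := T)).exists_bound_of_continuousOn
    (((modalAdjGen 𝔸 k).continuous.comp (continuous_modalAdjCoeff 𝔸 k t z)).continuousOn)
  refine ⟨max C 0, le_max_right _ _, fun τ hτ s hs y => ?_⟩
  have hsub : modalAdjField 𝔸 k t z τ y - modalAdjField 𝔸 k t z s y =
      realTrigPoly {k} (fun _ => modalAdjCoeff 𝔸 k t z τ - modalAdjCoeff 𝔸 k t z s) y := by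
    rw [show (fun _ : d → ℤ => modalAdjCoeff 𝔸 k t z τ - modalAdjCoeff 𝔸 k t z s) =
      (fun _ : d → ℤ => modalAdjCoeff 𝔸 k t z τ) - (fun _ : d → ℤ => modalAdjCoeff 𝔸 k t z s) from rfl, realTrigPoly_sub]
    rfl
  rw [hsub]
  refine (norm_realTrigPoly_singleton_le k _ y).trans ?_
  -- mean value inequality for the `C¹` curve `c` on `[0,T]`
  have hmv := (convex_Icc (0:ℝ) T).norm_image_sub_le_of_norm_deriv_le
    (f := modalAdjCoeff 𝔸 k t z) (fun σ _ => (differentiable_modalAdjCoeff 𝔸 k t z σ))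
    (fun σ hσ => by
      rw [deriv_modalAdjCoeff]
      exact (hC σ hσ).trans (le_max_left C 0)) hs hτ
  simpa [Real.norm_eq_abs] using hmv

omit [DecidableEq d] in
/-- Transversality of the coefficient family on `{k}` (`k ≠ 0`, `k · z = 0`). [cite: Temam1984, Ch. III §1.1] -/
theorem isTransversal_modalAdjCoeff (𝔸 : Visc4 d) {k : d → ℤ} (hk : k ≠ 0) (t : ℝ) {z : EuclideanSpace ℂ d}
    (hz : kdot k z = 0) (τ : ℝ) : IsTransversal {k} (fun _ => modalAdjCoeff 𝔸 k t z τ) := by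
  intro k' hk'
  rw [Finset.mem_singleton] at hk'
  subst hk'
  exact kdot_modalAdjCoeff 𝔸 hk t hz τ

/-- **The slices are divergence free** (`k ≠ 0`, `k · z = 0`). [cite: Temam1984, Ch. III §1.1] -/
theorem isDivFree_modalAdjField (𝔸 : Visc4 d) {k : d → ℤ} (hk : k ≠ 0) (t : ℝ) {z : EuclideanSpace ℂ d}
    (hz : kdot k z = 0) (τ : ℝ) : IsDivFree (modalAdjField 𝔸 k t z τ) :=
  isDivFree_realTrigPoly (isTransversal_modalAdjCoeff 𝔸 hk t hz τ)

omit [DecidableEq d] in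
/-- Pointwise bound of the slices by the coefficient: `‖φ τ y‖ ≤ ‖c τ‖`. [cite: LionsMagenes1972, Ch. 3 §4.3] -/
theorem norm_modalAdjField_le (𝔸 : Visc4 d) (k : d → ℤ) (t : ℝ) (z : EuclideanSpace ℂ d) (τ : ℝ) (y : UnitAddTorus d) :
    ‖modalAdjField 𝔸 k t z τ y‖ ≤ ‖modalAdjCoeff 𝔸 k t z τ‖ :=
  norm_realTrigPoly_singleton_le k _ y

omit [DecidableEq d] in
/-- In a window `NearIso 𝔸 lo hi` with `lo ≥ 0`, transversal data and `τ ≤ t`: `‖φ τ y‖ ≤ ‖z‖`. [cite: LionsMagenes1972, Ch. 3 §4.3] -/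
theorem norm_modalAdjField_le_of_le {𝔸 : Visc4 d} {lo hi : ℝ} (h𝔸 : NearIso 𝔸 lo hi) (hlo : 0 ≤ lo)
    {k : d → ℤ} (hk : k ≠ 0) (t : ℝ) {z : EuclideanSpace ℂ d} (hz : kdot k z = 0) {τ : ℝ} (hτ : τ ≤ t)
    (y : UnitAddTorus d) : ‖modalAdjField 𝔸 k t z τ y‖ ≤ ‖z‖ :=
  (norm_modalAdjField_le 𝔸 k t z τ y).trans (norm_modalAdjCoeff_le h𝔸 hlo hk t hz hτ)

end Field

/-! ## §4 The pointwise ADJOINT IDENTITY `φ′ + 𝓛_𝔸^* φ = ∇q` -/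

section Identity

open FunctionSpaces FunctionSpaces.Torus UnitAddTorus

omit [DecidableEq d] in
/-- The algebra behind the identity: `L_k c − 4π² T_𝔸(k) c = g • k` with `g` the gradient coefficient. [cite: LionsMagenes1972, Ch. 3 §4.3] -/
theorem modalAdjGen_sub_symbT (𝔸 : Visc4 d) (k : d → ℤ) (t : ℝ) (z : EuclideanSpace ℂ d) (τ : ℝ) :
    modalAdjGen 𝔸 k (modalAdjCoeff 𝔸 k t z τ) + (-(4 * Real.pi ^ 2 : ℝ) : ℂ) • symbT 𝔸 k (modalAdjCoeff 𝔸 k t z τ) =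
      modalAdjGradCoeff 𝔸 k t z τ • waveVecC k := by
  rw [modalAdjGen_apply, transversalProj_apply, modalAdjGradCoeff, smul_sub, smul_smul]
  have e : ((4 * Real.pi ^ 2 : ℝ) : ℂ) • symbT 𝔸 k (modalAdjCoeff 𝔸 k t z τ) +
      (-(4 * Real.pi ^ 2 : ℝ) : ℂ) • symbT 𝔸 k (modalAdjCoeff 𝔸 k t z τ) = 0 := by
    rw [← add_smul]; push_cast; ring_nf; simp
  rw [sub_eq_add_neg, add_assoc, add_comm (-( _ • waveVecC k)), ← add_assoc, e, zero_add, ← neg_smul]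
  congr 1
  push_cast
  ring

omit [DecidableEq d] in
/-- The modal pressure is smooth in space. [cite: LionsMagenes1972, Ch. 3 §4.3] -/
theorem isSmooth_modalAdjPressure (𝔸 : Visc4 d) (k : d → ℤ) (t : ℝ) (z : EuclideanSpace ℂ d) (τ : ℝ) :
    IsSmooth (modalAdjPressure 𝔸 k t z τ) :=
  isSmooth_re_trigPoly _ _

/-- The gradient of the modal pressure is the plane wave `Re(e_k • g(τ) k)`. [cite: LionsMagenes1972, Ch. 3 §4.3] -/
theorem gradient_modalAdjPressure (𝔸 : Visc4 d) (k : d → ℤ) (t : ℝ) (z : EuclideanSpace ℂ d) (τ : ℝ) (y : UnitAddTorus d) :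
    gradient (modalAdjPressure 𝔸 k t z τ) y = realTrigPoly {k} (fun _ => modalAdjGradCoeff 𝔸 k t z τ • waveVecC k) y := by
  have h1 : IsContDiff 1 (modalAdjPressure 𝔸 k t z τ) := (isSmooth_modalAdjPressure 𝔸 k t z τ).isContDiff (by simp)
  rw [gradient_eq_sum_partialDeriv h1]
  ext j
  rw [WithLp.ofLp_sum, Finset.sum_apply, Finset.sum_eq_single j (fun i _ hij => by simp [hij]) (by simp)]
  have hq : FunctionSpaces.Torus.partialDeriv j (modalAdjPressure 𝔸 k t z τ) y =
      ((2 * Real.pi * Complex.I * (k j : ℂ)) * ((2 * Real.pi * Complex.I)⁻¹ * modalAdjGradCoeff 𝔸 k t z τ) * mFourier k y).re := by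
    have e : modalAdjPressure 𝔸 k t z τ = fun y => (trigPoly {k} (fun _ => (2 * Real.pi * Complex.I)⁻¹ * modalAdjGradCoeff 𝔸 k t z τ) y).re := rfl
    rw [e, partialDeriv_re_trigPoly, trigPoly_apply, Finset.sum_singleton, smul_eq_mul, smul_eq_mul]
    ring_nf
  rw [realTrigPoly_apply_coord, trigPoly_apply_coord, Finset.sum_singleton]
  simp only [PiLp.smul_apply, smul_eq_mul, waveVecC_apply]
  rw [show (EuclideanSpace.single j (1:ℝ)).ofLp j = 1 by simp, mul_one, hq]
  congr 1
  have hI : (2 * (Real.pi : ℂ) * Complex.I) ≠ 0 := by simp [Real.pi_ne_zero, Complex.I_ne_zero]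
  field_simp

/-- **THE POINTWISE ADJOINT IDENTITY**: `φ′ τ y + 𝓛_𝔸^* (φ τ) y = ∇(q τ) y` at every `τ, y` — the modal
field solves the backward adjoint problem of the constant-tensor class CLASSICALLY, with the explicit
single-mode pressure. [cite: LionsMagenes1972, Ch. 3 §4.3] [cite: Frisch1995Turbulence, §9.6.3 eq. (9.57) p. 233] -/
theorem modalAdjFieldDeriv_add_viscAdj (𝔸 : Visc4 d) (k : d → ℤ) (t : ℝ) (z : EuclideanSpace ℂ d) (τ : ℝ) (y : UnitAddTorus d) :
    modalAdjFieldDeriv 𝔸 k t z τ y + viscAdj 𝔸 (modalAdjField 𝔸 k t z τ) y =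
      gradient (modalAdjPressure 𝔸 k t z τ) y := by
  rw [gradient_modalAdjPressure, modalAdjField, viscAdj_realTrigPoly_singleton, modalAdjFieldDeriv,
    ← Pi.add_apply (realTrigPoly {k} _) (realTrigPoly {k} _) y, ← realTrigPoly_add]
  refine congrFun (realTrigPoly_congr fun k' hk' => ?_) y
  rw [Finset.mem_singleton] at hk'
  subst hk'
  rw [Pi.add_apply]
  exact modalAdjGen_sub_symbT 𝔸 k' t z τ

end Identity

end Torus

end Literature.Analysis.FluidPDE

end
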